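import Literature.NumberTheory.Automorphic.GL4NonSelfDualIrreducible
import Literature.NumberTheory.Automorphic.BockleHuiIrreducibleGL3
import Literature.NumberTheory.Automorphic.ClozelAlgebraicity
import Literature.NumberTheory.Automorphic.LieAlgebraGLBracket
import Literature.NumberTheory.PAdicHodge.FontaineDpst
import Literature.NumberTheory.GaloisRepresentations.LabelledHodgeTateWeights
import Literature.NumberTheory.GaloisRepresentations.ResidualGaloisRep
import Mathlib.Algebra.Lie.Solvable
import HarnessLib

/-!
# Calegari–Gee 2013, §8 (Thms. 8.6, 8.7, 8.8): non-essentially-self-dual regular algebraic cuspidal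
# `π` on `GL_3` / `GL_4` over a totally real field — irreducibility, residual irreducibility and
# `λ`-independence of the monodromy Lie algebra, GIVEN a weakly compatible system attached to `π`

Topic `NumberTheory/Automorphic`; namespace `Literature.NumberTheory.Automorphic` (facts in the
sub-namespace `CalegariGee2013`).  Requested by cite item `wi-39817` (planner of crux
`stmt-Langlands-16781`, cards `reflection-seed-closure` P3 / `purity-pins-monodromy-gl3`; use: the
irreducibility clause of the `(A)`-leaf `SatakeAvatarExistence` on the sector
`{n = 3, F totally real, π regular}`).

## Sources, as printed (held texts read 2026-08-17)

F. Calegari, T. Gee, *Irreducibility of automorphic Galois representations of `GL(n)`, `n` at most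
`5`*, Ann. Inst. Fourier 63 (2013) 1881–1912 = arXiv:1104.4827 [CalegariGee2013], **§8 "Non
self-dual representations of `GL_3` and `GL_4`"** (arXiv pp. 18–19):

> In this section, we follow [Ramakrishnan] and sketch a proof that our earlier irreducibility
> results extend to the case of regular algebraic cuspidal automorphic representations `π` of
> `GL_3(𝔸_F)` or `GL_4(𝔸_F)`, `F` a totally real field, without assuming that `π` is essentially
> self-dual, but with the assumption that the Galois representations `r_λ(π)` exist.
> Assume throughout this section that `F` is totally real, that `n = 3` or `4` and that there is a
> weakly compatible system `{r_λ(π)}` of Galois representations associated to `π`.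
> **Theorem 8.6.** `r_λ(π)` is irreducible for all `λ`.
> **Theorem 8.7.** For all but finitely many `λ`, `r̄_λ(π)` is irreducible.
> **Theorem 8.8.** Let `𝔤_λ` be the Lie algebra of the Zariski closure of `r_λ(G_F)`. Then `𝔤_λ` is
> independent of `λ`.

("weakly compatible system" = [BarnetlambEtAl2014] §5.1, to which §2.1 of the source refers: "a
`5`-tuple `(M, S, {Q_v(X)}, {r_λ}, {H_τ})` where `M` is a number field; `S` is a finite set of
primes of `F`; for each prime `v ∉ S` of `F`, `Q_v(X)` is a monic degree `n` polynomial in `M[X]`;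
for each prime `λ` of `M` (with residue characteristic `l` say) `r_λ : G_F → GL_n(M̄_λ)` is a
continuous, semi-simple, representation such that if `v ∉ S` and `v ∤ l` is a prime of `F` then
`r_λ` is unramified at `v` and `r_λ(Frob_v)` has characteristic polynomial `Q_v(X)`, while if
`v | l` then `r_λ|_{G_{F_v}}` is de Rham and in the case `v ∉ S` crystalline; for `τ : F ↪ M̄`,
`H_τ` is a multiset of `n` integers such that for any `M̄ ↪ M̄_λ` over `M` we have
`HT_τ(r_λ) = H_τ`. … We will call `𝓡` regular if for each `τ` every element of `H_τ` has
multiplicity `1`."  "Associated to `π`": `Q_v` is the characteristic polynomial of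
`rec(π_v ⊗ |det|^{(1-n)/2})(Frob_v)` for unramified `π_v`, loc. cit. §2.1.)

## STATUS of §8 (read this before citing)

* **Corrigendum** [CalegariGee2017corrigendum] (Ann. Inst. Fourier 67 (2017) 267–268), verbatim:
  "We explain a serious error in our original paper, which means that the main claimed theorems
  remain unproved. … There is an error in (the statement of) Theorem 4.7, namely, it does not apply
  to the group `H = GO(V) ⊂ GL(V)` when `dim(V) = 5`. This invalidates the proof of Theorem 4.1
  both for `n = 5` and `n = 4`. For `n = 4`, our methods seem inadequate to distinguish between the
  possibility that the Lie algebra of the image is `sl₂ × sl₂` or `sp₄` … The results of the first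
  three sections remain valid, as do Lemma 4.3 and Corollary 4.4, and the results of Section 5."
  Section 8 is NOT among the results the corrigendum lists as remaining valid (nor among those it
  declares invalid).  Its proofs are sketches that re-run the proofs of Lemma 4.8 / Cor. 4.9 /
  Thm. 4.7 / Lemma 6.2 / Thm. 7.1 in dimensions `3` and `4` (where Theorem 4.7 is correct: the
  faulty case is `GO₅`) and a direct `𝔰𝔬₆ = ∧²𝔰𝔩₄` fixed-vector argument for `∧² r_λ` when `n = 4`.
* A. Shavali, arXiv:2603.19768 (2026), p. 3 [Shavali2026GL4]: "conditional on the local-global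
  compatibility at `ℓ = p` …, Calegari and Gee show the irreducibility of `ρ_{π,𝔭}` in the
  non-self-dual case for `n = 3` and `4` [CG13] (they implicitly use local-global compatibility in
  [CG13]). Note that there is an error in that paper, but we believe that it does not affect the
  proof in the non-self-dual case."
* What the tree ALREADY holds, from other sources, and which SUPERSEDES Theorem 8.6:
  `n = 3`: `isIrreducible_galoisRep_gl3_totallyReal` — Böckle–Hui, Math. Ann. 393 (2025), Thm. 1.2
  [BockleHui2025]: irreducibility of `ρ_{π,ι}` for EVERY `(ℓ, ι)`, for every regular algebraic
  cuspidal `π` on `GL_3` over a totally real field, with NO self-duality and NO `p`-adic Hodge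
  hypothesis (refereed, unconditional); `n = 4`: `isIrreducible_galoisRep_gl4_totallyReal_of_not_essSelfDual`
  — Shavali 2026, Thm. A (an arXiv claim under review, tagged so in its own file, D-0012): the same
  for `π` not essentially self-dual on `GL_4`.  Accordingly Theorem 8.6 is NOT re-vendored as a new
  fact: it is PROVED below
  (`CalegariGee2013.isIrreducible_of_isWeaklyCompatibleFamily`) from those two facts, for the weakly
  compatible families of this file.  Theorems 8.7 and 8.8 are vendored as named facts citing
  [CalegariGee2013] together with the corrigendum; consumers should weigh the status paragraph above
  (for `n = 3`, Böckle–Hui, Rem. 3.5, assert the conclusion of Thm. 8.7 for STRICTLY compatible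
  regular systems, from their Thm. 1.2 and Hui, Bull. LMS 55 (2023); and their Thm. 3.2 proves the
  `λ`-independence of the irreducible type of `ρ_{π,λ}` for `n = 3` unconditionally).

## Rendering (WEAKER than the source, never stronger — except for the one reading choice flagged)

* `F` totally real (`NumberField.IsTotallyReal`), `n = 3 ∨ n = 4`, `π : CuspidalAutomorphicRepData`
  regular algebraic (`IsRegularAlgebraic`).
* "`π` is not essentially self-dual" at SATAKE LEVEL, VERBATIM the hypothesis of the accepted
  `isIrreducible_galoisRep_gl4_totallyReal_of_not_essSelfDual` (here named
  `IsSatakeNonEssSelfDual h1 π`): no cuspidal `GL(1)` datum `η` with `t_{π,v}⁻¹ = η(ϖ_v)·t_{π,v}`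
  for almost all `v`.  If `π^∨ ≅ π ⊗ (χ∘det)` then the datum of `χ` is such an `η`, so this
  hypothesis implies the printed one and the facts below are implied by the printed theorems.
* THE WEAKLY COMPATIBLE SYSTEM, `(ℓ, ι)`-indexed and read on Fontaine's PINNED datum
  (`fontainePstAdicCompletion`, D-0018 L2) — `IsWeaklyCompatibleFamily π r H` for a family
  `r ℓ ι : Γ_F → GL_n(ℚ̄_ℓ)` and `H : (F →+* ℂ) → Multiset ℤ`:
  (M) a number field `E ⊂ ℂ` containing the unramified Hecke eigenvalues `t_{v,i}` of `π` at all but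
      finitely many `v` (shape of the accepted `Clozel1990_heckeEigenvalueField`; equivalently
      `Q_v ∈ E[X]`, `S ⊇` the exceptional places);
  (i) every `r ℓ ι` is semisimple and, at EVERY finite `v ∤ ℓ` where `π` has a Satake parameter `α`,
      unramified with arithmetic-Frobenius characteristic polynomial `arithFrobPolyOfSatake ι q_v n α`
      (the attachment clause of `exists_galoisRep_of_regularAlgebraic`, lang.S27; this is (i) of
      [BLGGT] for every admissible `S`, i.e. a STRONGER hypothesis);
  (ii) at every `v ∣ ℓ`: de Rham, and crystalline whenever `π` is unramified at `v` (again stronger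
      than "crystalline for `v ∉ S`");
  (iii) for every `v ∣ ℓ` and continuous `τ : F_v → ℚ̄_ℓ`, `HT_τ(r ℓ ι) = H(ι ∘ τ|_F)`, `card H(σ) = n`
      — the `λ`-independent labelled weights, indexed by `σ : F → ℂ` (`= τ : F ↪ M̄` read in `ℂ`;
      `ι⁻¹ ∘ σ` is one of the embeddings "`M̄ ↪ M̄_λ` over `M`").
  Regularity of `H` (`∀ σ, (H σ).Nodup`) is a separate hypothesis of the facts.
  INDEXING: `(ℓ, ι : ℚ̄_ℓ ≃ ℂ)` instead of the primes `λ` of `M` is the reparametrisation already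
  used by the accepted `BLGGT2014_polarized_compatibleSystem_rationalModels` (its module docstring):
  `ι⁻¹|_E` induces `λ ∣ ℓ` and an `M`-embedding `M̄ ↪ M̄_λ ≅ ℚ̄_ℓ`, along which `r_λ` becomes an `r ℓ ι`
  with (i)–(iii); conversely a family gives a system by choosing one `ι` per `λ` (two choices differ
  by `Aut(ℚ̄_ℓ/ℚ_ℓ)`, which preserves (residual) irreducibility and Lie-algebra dimensions), and
  "all but finitely many `λ`" is "all but finitely many `ℓ`, every `ι`" (finitely many `λ ∣ ℓ`).
  READING CHOICE (flagged): "associated to `π`" is rendered by (M)+(i) — the Frobenius polynomials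
  are those of `π` — with `H` an abstract `λ`-independent regular weight function rather than the
  shifted weight `{a_{τ,1}+n-1, …, a_{τ,n}}` of `π` (whose pairing with the tree's `InfinityType`
  normalisations is not fixed in the tree, cf. the module docstring of `AHTW2026LocalGlobalAtP`);
  of the weights, §8 uses only their regularity, their `λ`-independence and (for `l ≫ 0`) the
  Fontaine–Laffaille range ([CalegariGee2013], proofs of Cor. 4.4, Prop. 2.5–2.7, Lemma 6.2).
* CONCLUSIONS.  8.7: the set of primes `ℓ` at which some `r ℓ ι` fails to be residually absolutely
  irreducible (`FramedGaloisRep.IsResiduallyAbsIrreducible`: some reduction over `ℤ̄_ℓ/𝔪 ≅ 𝔽̄_ℓ`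
  is absolutely irreducible — for the semisimplified reduction `r̄` of the source, "`r̄` irreducible
  over `𝔽̄_ℓ`" is exactly this) is finite.  8.8, in the invariant form the tree can state across
  different coefficient fields `ℚ̄_ℓ`: the dimension of `𝔤 = Lie(Zariski closure of the image)`
  (`lieAlgebraGL`, Springer 4.1.3 — the Lie algebra of a subgroup IS that of its Zariski closure,
  `lieSubalgebraGL_zariskiClosure`) and of its derived subalgebra `[𝔤, 𝔤]` (the semisimple part `𝔥`
  of the reductive `𝔤 = 𝔷 ⊕ 𝔥` of the source) do not depend on `(ℓ, ι)` — implied by "`𝔤_λ` is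
  independent of `λ`"; weaker than print.

## References

* [CalegariGee2013] Ann. Inst. Fourier 63 (2013), §8: Lemmas 8.1–8.5, Thm. 8.6, Thm. 8.7,
  Thm. 8.8 (arXiv:1104.4827 pp. 18–19); §2.1 (the systems `r_λ(π)`), Def. 4.2, Prop. 4.5.
* [CalegariGee2017corrigendum] Ann. Inst. Fourier 67 (2017) 267–268.
* [BarnetlambEtAl2014] Ann. of Math. 179 (2014), §5.1 (weakly compatible systems; regular).
* [BockleHui2025] Math. Ann. 393 (2025), Thm. 1.2, Thm. 3.2, Rem. 3.5.
* [Shavali2026GL4] arXiv:2603.19768, Thm. A, p. 3.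
* [HarrisLanTaylorThorneRMS2016] Res. Math. Sci. 3 (2016), Thm. A (the candidates `r_{ℓ,ι}(π)`).
-/

noncomputable section

open scoped NumberField
open NumberField IsDedekindDomain Filter
open Literature.NumberTheory.GaloisRepresentations Literature.NumberTheory.PAdicHodge

namespace Literature.NumberTheory.Automorphic

section Vocabulary

variable {n : ℕ} {F : Type} [Field F] [NumberField F]

/-- An **`(ℓ, ι)`-indexed family of framed `ℓ`-adic Galois representations of `Γ_F` of rank `n`**:
for every prime `ℓ` and every field isomorphism `ι : ℚ̄_ℓ ≃ ℂ` a continuous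
`r ℓ ι : Γ_F → GL_n(ℚ̄_ℓ)` — the indexing of `r_{ℓ,ι}(π)` (Harris–Lan–Taylor–Thorne, Thm. A) and the
tree's reparametrisation of the `λ`-indexed systems of [BarnetlambEtAl2014] §5.1 (module
docstring). [cite: HarrisLanTaylorThorneRMS2016, Thm. A] -/
abbrev GaloisRepFamily (F : Type) [Field F] [NumberField F] (n : ℕ) : Type :=
  ∀ (ℓ : ℕ) [Fact ℓ.Prime], (PadicAlgCl ℓ ≃+* ℂ) → FramedGaloisRep F (PadicAlgCl ℓ) n

/-- **`π` is not essentially self-dual, at Satake level** (VERBATIM the hypothesis of the accepted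
`isIrreducible_galoisRep_gl4_totallyReal_of_not_essSelfDual`): there is no cuspidal `GL(1)` datum
`η` (at the level witness `h1`) such that `t_{π,v}⁻¹ = η(ϖ_v) · t_{π,v}` as multisets for almost
all `v`.  If `π^∨ ≅ π ⊗ (χ ∘ det)` for a Hecke character `χ` then the datum of `χ` is such an `η`
(`t_{π^∨,v} = t_{π,v}⁻¹`, `t_{π⊗χ,v} = χ(ϖ_v) t_{π,v}`, Jacquet–Shalika), so this implies "`π` is not
essentially self-dual" in the sense of the source (§2.1: `π ≇ π^∨ ⊗ (χ ∘ det)` for every `χ`).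
[cite: CalegariGee2013, §2.1 and §8 (standing hypothesis)] -/
def IsSatakeNonEssSelfDual (h1 : isCompact_glFiniteIntegralLevel 1 F)
    {hcpt : isCompact_glFiniteIntegralLevel n F} (π : CuspidalAutomorphicRepData n F hcpt) : Prop :=
  ∀ η : CuspidalAutomorphicRepData 1 F h1,
    ¬ ∀ᶠ v : HeightOneSpectrum (𝓞 F) in cofinite, ∀ α : Multiset ℂ, π.1.HasSatakeParamAt v α →
      ∃ e : ℂ, η.1.HasSatakeParamAt v {e} ∧ α.map (fun a => a⁻¹) = α.map (fun a => e * a)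

/-- Unfolding lemma for `IsSatakeNonEssSelfDual`. [folklore] -/
theorem isSatakeNonEssSelfDual_iff (h1 : isCompact_glFiniteIntegralLevel 1 F)
    {hcpt : isCompact_glFiniteIntegralLevel n F} (π : CuspidalAutomorphicRepData n F hcpt) :
    IsSatakeNonEssSelfDual h1 π ↔
      ∀ η : CuspidalAutomorphicRepData 1 F h1,
        ¬ ∀ᶠ v : HeightOneSpectrum (𝓞 F) in cofinite, ∀ α : Multiset ℂ,
          π.1.HasSatakeParamAt v α →
            ∃ e : ℂ, η.1.HasSatakeParamAt v {e} ∧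
              α.map (fun a => a⁻¹) = α.map (fun a => e * a) :=
  Iff.rfl

/-- **A weakly compatible system of `ℓ`-adic representations associated to `π`**
([BarnetlambEtAl2014] §5.1, as used in [CalegariGee2013] §8), `(ℓ, ι)`-indexed and read on
Fontaine's pinned datum `fontainePstAdicCompletion v ℓ hv = (B_dR(F_v), WD ∘ D_pst)`:
(M) a number field `E ⊂ ℂ` contains the unramified Hecke eigenvalues `t_{v,i}(π)`, `0 ≤ i ≤ n`, at
all but finitely many finite `v` ("`Q_v(X) ∈ M[X]` for `v ∉ S`"); (card) every `H σ` has `n`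
elements; and for every prime `ℓ` and `ι : ℚ̄_ℓ ≃ ℂ`: `r ℓ ι` is semisimple; at every finite
`v ∤ ℓ` where `π` has a Satake parameter `α`, `r ℓ ι` is unramified with arithmetic-Frobenius
characteristic polynomial `arithFrobPolyOfSatake ι q_v n α` ("unramified at `v` and `r_λ(Frob_v)`
has characteristic polynomial `Q_v(X)`", `Q_v` that of `π_v`; lang.S27 normalisation); at every
`v ∣ ℓ`, `r ℓ ι|_{Γ_{F_v}}` is de Rham (`IsDeRhamFramed`), crystalline (`IsCrystallineFramed`) if
`π` is unramified at `v`, and for every continuous `τ : F_v → ℚ̄_ℓ` its `τ`-labelled Hodge–Tate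
weights (`labelledHodgeTateWeightsAt`) are `H(ι ∘ τ|_F)` ("`HT_τ(r_λ) = H_τ` for any `M̄ ↪ M̄_λ`
over `M`").  Clauses (i)–(ii) are demanded at every unramified place of `π` (stronger than
[BLGGT]'s "for `v ∉ S`"); regularity of `H` is NOT part of this predicate.  See the module
docstring (INDEXING, READING CHOICE). [cite: BarnetlambEtAl2014, §5.1]
[cite: CalegariGee2013, §8 (standing hypothesis) and §2.1] -/
def IsWeaklyCompatibleFamily {hcpt : isCompact_glFiniteIntegralLevel n F}
    (π : CuspidalAutomorphicRepData n F hcpt) (r : GaloisRepFamily F n)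
    (H : (F →+* ℂ) → Multiset ℤ) : Prop :=
  (∃ E : Subfield ℂ, FiniteDimensional ℚ E ∧
      ∀ᶠ v : HeightOneSpectrum (𝓞 F) in cofinite, ∀ α : Multiset ℂ,
        π.1.HasSatakeParamAt v α → ∀ i ≤ n, heckeEigenvalueOf n v α i ∈ E) ∧
  (∀ σ : F →+* ℂ, Multiset.card (H σ) = n) ∧
  ∀ (ℓ : ℕ) [Fact ℓ.Prime] (ι : PadicAlgCl ℓ ≃+* ℂ),
    (r ℓ ι).toGaloisRep.IsSemisimple ∧
    (∀ (v : HeightOneSpectrum (𝓞 F)) (α : Multiset ℂ), π.1.HasSatakeParamAt v α →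
        ((ℓ : ℕ) : 𝓞 F) ∉ v.asIdeal →
          (r ℓ ι).IsUnramifiedAt v ∧
            (r ℓ ι).HasFrobCharpolyAt v (arithFrobPolyOfSatake ι v.residueCard n α)) ∧
    ∀ (v : HeightOneSpectrum (𝓞 F)) (hv : ((ℓ : ℕ) : 𝓞 F) ∈ v.asIdeal),
      (fontainePstAdicCompletion v ℓ hv).IsDeRhamFramed ((r ℓ ι).toLocal v) ∧
      (π.1.IsUnramifiedAt v →
        (fontainePstAdicCompletion v ℓ hv).IsCrystallineFramed ((r ℓ ι).toLocal v)) ∧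
      ∀ τ : v.adicCompletion F →+* PadicAlgCl ℓ, Continuous τ →
        (r ℓ ι).labelledHodgeTateWeightsAt v (fontainePstAdicCompletion v ℓ hv).algebra
            (fontainePstAdicCompletion v ℓ hv).𝔅 τ =
          H (ι.toRingHom.comp (τ.comp (algebraMap F (v.adicCompletion F))))

/-- The attachment clause of a weakly compatible family at `(ℓ, ι)`: `r ℓ ι` is semisimple and
Satake–Frobenius compatible with `(π, ι)` at every finite `v ∤ ℓ` where `π` is unramified — the
hypothesis shape of `isIrreducible_galoisRep_gl3_totallyReal` and of lang.S27. [folklore] -/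
theorem IsWeaklyCompatibleFamily.attached {hcpt : isCompact_glFiniteIntegralLevel n F}
    {π : CuspidalAutomorphicRepData n F hcpt} {r : GaloisRepFamily F n}
    {H : (F →+* ℂ) → Multiset ℤ} (h : IsWeaklyCompatibleFamily π r H)
    (ℓ : ℕ) [Fact ℓ.Prime] (ι : PadicAlgCl ℓ ≃+* ℂ) :
    (r ℓ ι).toGaloisRep.IsSemisimple ∧
      ∀ (v : HeightOneSpectrum (𝓞 F)) (α : Multiset ℂ), π.1.HasSatakeParamAt v α →
        ((ℓ : ℕ) : 𝓞 F) ∉ v.asIdeal →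
          (r ℓ ι).IsUnramifiedAt v ∧
            (r ℓ ι).HasFrobCharpolyAt v (arithFrobPolyOfSatake ι v.residueCard n α) :=
  ⟨(h.2.2 ℓ ι).1, (h.2.2 ℓ ι).2.1⟩

/-- The `p`-adic Hodge clauses of a weakly compatible family at `(ℓ, ι)` and `v ∣ ℓ`: de Rham,
crystalline where `π` is unramified, and labelled Hodge–Tate weights `H(ι ∘ τ|_F)`. [folklore] -/
theorem IsWeaklyCompatibleFamily.at_prime {hcpt : isCompact_glFiniteIntegralLevel n F}
    {π : CuspidalAutomorphicRepData n F hcpt} {r : GaloisRepFamily F n}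
    {H : (F →+* ℂ) → Multiset ℤ} (h : IsWeaklyCompatibleFamily π r H)
    (ℓ : ℕ) [Fact ℓ.Prime] (ι : PadicAlgCl ℓ ≃+* ℂ) (v : HeightOneSpectrum (𝓞 F))
    (hv : ((ℓ : ℕ) : 𝓞 F) ∈ v.asIdeal) :
    (fontainePstAdicCompletion v ℓ hv).IsDeRhamFramed ((r ℓ ι).toLocal v) ∧
      (π.1.IsUnramifiedAt v →
        (fontainePstAdicCompletion v ℓ hv).IsCrystallineFramed ((r ℓ ι).toLocal v)) ∧
      ∀ τ : v.adicCompletion F →+* PadicAlgCl ℓ, Continuous τ →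
        (r ℓ ι).labelledHodgeTateWeightsAt v (fontainePstAdicCompletion v ℓ hv).algebra
            (fontainePstAdicCompletion v ℓ hv).𝔅 τ =
          H (ι.toRingHom.comp (τ.comp (algebraMap F (v.adicCompletion F)))) :=
  (h.2.2 ℓ ι).2.2 v hv

end Vocabulary

namespace CalegariGee2013

/-- **Calegari–Gee 2013, Theorem 8.7 (residual irreducibility for all but finitely many `λ`),
NAMED FACT — see the STATUS paragraph of the module docstring (corrigendum
[CalegariGee2017corrigendum]; §8 is a sketch not re-asserted there).**  Let `F` be a totally real
number field, `n = 3` or `4`, `π` a regular algebraic cuspidal automorphic representation of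
`GL_n(𝔸_F)` which is not essentially self-dual (Satake level, `IsSatakeNonEssSelfDual h1 π`), and
`{r ℓ ι}` a weakly compatible system associated to `π` (`IsWeaklyCompatibleFamily π r H`) with
regular weights (`∀ σ, (H σ).Nodup`).  Then for all but finitely many primes `ℓ`, every `r ℓ ι` is
residually absolutely irreducible: the set of `ℓ` at which some `r ℓ ι` has no absolutely
irreducible reduction is finite.  Printed: "Assume throughout this section that `F` is totally
real, that `n = 3` or `4` and that there is a weakly compatible system `{r_λ(π)}` of Galois
representations associated to `π`. … Theorem 8.7. For all but finitely many `λ`, `r̄_λ(π)` is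
irreducible."  (`λ ↔ (ℓ, ι)` and the renderings: module docstring.)
[cite: CalegariGee2013, Thm. 8.7 (with the standing hypothesis of §8 and [BLGGT] §5.1)]
[cite: CalegariGee2017corrigendum, p. 267 (status)] -/
def residuallyIrreducible_cofinite : Prop :=
  ∀ (F : Type) [Field F] [NumberField F], IsTotallyReal F →
    ∀ (n : ℕ), (n = 3 ∨ n = 4) →
    ∀ (h1 : isCompact_glFiniteIntegralLevel 1 F) (hcpt : isCompact_glFiniteIntegralLevel n F)
      (π : CuspidalAutomorphicRepData n F hcpt), π.1.IsRegularAlgebraic →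
      IsSatakeNonEssSelfDual h1 π →
      ∀ (r : GaloisRepFamily F n) (H : (F →+* ℂ) → Multiset ℤ),
        IsWeaklyCompatibleFamily π r H → (∀ σ : F →+* ℂ, (H σ).Nodup) →
        {ℓ : ℕ | ∃ (_ : Fact ℓ.Prime) (ι : PadicAlgCl ℓ ≃+* ℂ),
            ¬ (r ℓ ι).IsResiduallyAbsIrreducible}.Finite

/-- Unfolding lemma for `residuallyIrreducible_cofinite`. [folklore] -/
theorem residuallyIrreducible_cofinite_iff :
    residuallyIrreducible_cofinite ↔
      ∀ (F : Type) [Field F] [NumberField F], IsTotallyReal F →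
        ∀ (n : ℕ), (n = 3 ∨ n = 4) →
        ∀ (h1 : isCompact_glFiniteIntegralLevel 1 F) (hcpt : isCompact_glFiniteIntegralLevel n F)
          (π : CuspidalAutomorphicRepData n F hcpt), π.1.IsRegularAlgebraic →
          IsSatakeNonEssSelfDual h1 π →
          ∀ (r : GaloisRepFamily F n) (H : (F →+* ℂ) → Multiset ℤ),
            IsWeaklyCompatibleFamily π r H → (∀ σ : F →+* ℂ, (H σ).Nodup) →
            {ℓ : ℕ | ∃ (_ : Fact ℓ.Prime) (ι : PadicAlgCl ℓ ≃+* ℂ),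
                ¬ (r ℓ ι).IsResiduallyAbsIrreducible}.Finite :=
  Iff.rfl

/-- Hypothesis form of Theorem 8.7: outside a finite set of primes every member of the family is
residually absolutely irreducible. [cite: CalegariGee2013, Thm. 8.7] -/
theorem residuallyIrreducible_cofinite.eventually (h : residuallyIrreducible_cofinite)
    {F : Type} [Field F] [NumberField F] (hF : IsTotallyReal F) {n : ℕ} (hn : n = 3 ∨ n = 4)
    (h1 : isCompact_glFiniteIntegralLevel 1 F) {hcpt : isCompact_glFiniteIntegralLevel n F}
    (π : CuspidalAutomorphicRepData n F hcpt) (hπ : π.1.IsRegularAlgebraic)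
    (hnsd : IsSatakeNonEssSelfDual h1 π) {r : GaloisRepFamily F n}
    {H : (F →+* ℂ) → Multiset ℤ} (hr : IsWeaklyCompatibleFamily π r H)
    (hreg : ∀ σ : F →+* ℂ, (H σ).Nodup) :
    ∃ T : Finset ℕ, ∀ (ℓ : ℕ) [Fact ℓ.Prime], ℓ ∉ T →
      ∀ ι : PadicAlgCl ℓ ≃+* ℂ, (r ℓ ι).IsResiduallyAbsIrreducible := by
  refine ⟨(h F hF n hn h1 hcpt π hπ hnsd r H hr hreg).toFinset, fun ℓ _ hℓ ι => ?_⟩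
  by_contra hc
  exact hℓ (Set.Finite.mem_toFinset _ |>.mpr ⟨‹_›, ι, hc⟩)

-- Tree idiom (`LieAlgebraGLBracket.lean`): the commutator bracket on `Matrix n n k`, locally.
attribute [local instance 100] LieRing.ofAssociativeRing in
/-- **Calegari–Gee 2013, Theorem 8.8 (`λ`-independence of the monodromy Lie algebra), NAMED FACT,
in invariant form — see the STATUS paragraph of the module docstring.**  Same hypotheses as
`residuallyIrreducible_cofinite`.  For `G = r ℓ ι(Γ_F) ≤ GL_n(ℚ̄_ℓ)` let `𝔤(ℓ, ι) = Lie(Ḡ) ⊆ 𝔤𝔩ₙ(ℚ̄_ℓ)`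
be the Lie algebra of its Zariski closure (`lieSubalgebraGL`; `Lie(G) = Lie(Ḡ)`).  Then the
dimensions of `𝔤(ℓ, ι)` and of its derived subalgebra `[𝔤, 𝔤]` (the semisimple part `𝔥` of the
reductive `𝔤 = 𝔷 ⊕ 𝔥` of the source) are independent of `(ℓ, ι)`.  Printed: "Theorem 8.8. Let `𝔤_λ`
be the Lie algebra of the Zariski closure of `r_λ(G_F)`. Then `𝔤_λ` is independent of `λ`."
(with, in the proof, `𝔤_λ = 𝔥_λ ⊕ 𝔷_λ` and "it suffices to show that `𝔥_λ` is independent of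
`λ`"); equality of dimensions across the coefficient fields `ℚ̄_ℓ`, `ℚ̄_{ℓ'}` is implied by, and
weaker than, the printed statement.
[cite: CalegariGee2013, Thm. 8.8 (with the standing hypothesis of §8)]
[cite: CalegariGee2017corrigendum, p. 267 (status)] -/
def lieAlgebra_finrank_independent : Prop :=
  ∀ (F : Type) [Field F] [NumberField F], IsTotallyReal F →
    ∀ (n : ℕ), (n = 3 ∨ n = 4) →
    ∀ (h1 : isCompact_glFiniteIntegralLevel 1 F) (hcpt : isCompact_glFiniteIntegralLevel n F)
      (π : CuspidalAutomorphicRepData n F hcpt), π.1.IsRegularAlgebraic →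
      IsSatakeNonEssSelfDual h1 π →
      ∀ (r : GaloisRepFamily F n) (H : (F →+* ℂ) → Multiset ℤ),
        IsWeaklyCompatibleFamily π r H → (∀ σ : F →+* ℂ, (H σ).Nodup) →
        ∀ (ℓ : ℕ) [Fact ℓ.Prime] (ι : PadicAlgCl ℓ ≃+* ℂ)
          (ℓ' : ℕ) [Fact ℓ'.Prime] (ι' : PadicAlgCl ℓ' ≃+* ℂ),
          Module.finrank (PadicAlgCl ℓ)
              (lieSubalgebraGL (r ℓ ι : Field.absoluteGaloisGroup F →* GL (Fin n) (PadicAlgCl ℓ)).range) =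
            Module.finrank (PadicAlgCl ℓ')
              (lieSubalgebraGL
                (r ℓ' ι' : Field.absoluteGaloisGroup F →* GL (Fin n) (PadicAlgCl ℓ')).range) ∧
          Module.finrank (PadicAlgCl ℓ)
              (LieAlgebra.derivedSeries (PadicAlgCl ℓ)
                (lieSubalgebraGL
                  (r ℓ ι : Field.absoluteGaloisGroup F →* GL (Fin n) (PadicAlgCl ℓ)).range) 1) =
            Module.finrank (PadicAlgCl ℓ')
              (LieAlgebra.derivedSeries (PadicAlgCl ℓ')
                (lieSubalgebraGL
                  (r ℓ' ι' : Field.absoluteGaloisGroup F →* GL (Fin n) (PadicAlgCl ℓ')).range) 1)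

/-- **Theorem 8.6 for the families of this file is a THEOREM of the tree's facts** (and is
therefore not vendored as a fact): Böckle–Hui 2025, Thm. 1.2 (`n = 3`, unconditionally — neither
the non-self-duality nor the `p`-adic Hodge clauses are used) and Shavali 2026, Thm. A (`n = 4`,
claim under review) give the irreducibility of EVERY member `r ℓ ι` of a weakly compatible family
associated to a regular algebraic cuspidal `π` on `GL_n` over a totally real field, `π` not
essentially self-dual at Satake level.  Printed (CG): "Theorem 8.6. `r_λ(π)` is irreducible for
all `λ`."  (The `n = 4` input is the under-review claim of `GL4NonSelfDualIrreducible.lean`,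
taken here as the hypothesis `h4`.) [cite: BockleHui2025, Theorem 1.2]
[cite: CalegariGee2013, Thm. 8.6] -/
theorem isIrreducible_of_isWeaklyCompatibleFamily (h3 : isIrreducible_galoisRep_gl3_totallyReal)
    (h4 : isIrreducible_galoisRep_gl4_totallyReal_of_not_essSelfDual)
    {F : Type} [Field F] [NumberField F] (hF : IsTotallyReal F) {n : ℕ} (hn : n = 3 ∨ n = 4)
    (h1 : isCompact_glFiniteIntegralLevel 1 F) {hcpt : isCompact_glFiniteIntegralLevel n F}
    (π : CuspidalAutomorphicRepData n F hcpt) (hπ : π.1.IsRegularAlgebraic)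
    (hnsd : IsSatakeNonEssSelfDual h1 π) {r : GaloisRepFamily F n}
    {H : (F →+* ℂ) → Multiset ℤ} (hr : IsWeaklyCompatibleFamily π r H)
    (ℓ : ℕ) [Fact ℓ.Prime] (ι : PadicAlgCl ℓ ≃+* ℂ) :
    (r ℓ ι).toGaloisRep.IsIrreducible := by
  obtain ⟨hss, hcomp⟩ := hr.attached ℓ ι
  rcases hn with rfl | rfl
  · exact h3 F hF hcpt π hπ ℓ ι (r ℓ ι) hss hcomp
  · exact h4 F hF h1 hcpt π hπ hnsd ℓ ι (r ℓ ι) hss hcomp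

/-- The rank-`3` case needs neither the non-self-duality nor the weight hypotheses: every
semisimple Satake–Frobenius compatible `r ℓ ι` is irreducible (Böckle–Hui 2025, Thm. 1.2).
[cite: BockleHui2025, Theorem 1.2] -/
theorem isIrreducible_rank_three (h3 : isIrreducible_galoisRep_gl3_totallyReal)
    {F : Type} [Field F] [NumberField F] (hF : IsTotallyReal F)
    {hcpt : isCompact_glFiniteIntegralLevel 3 F} (π : CuspidalAutomorphicRepData 3 F hcpt)
    (hπ : π.1.IsRegularAlgebraic) {r : GaloisRepFamily F 3} {H : (F →+* ℂ) → Multiset ℤ}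
    (hr : IsWeaklyCompatibleFamily π r H) (ℓ : ℕ) [Fact ℓ.Prime] (ι : PadicAlgCl ℓ ≃+* ℂ) :
    (r ℓ ι).toGaloisRep.IsIrreducible := by
  obtain ⟨hss, hcomp⟩ := hr.attached ℓ ι
  exact h3 F hF hcpt π hπ ℓ ι (r ℓ ι) hss hcomp

end CalegariGee2013

end Literature.NumberTheory.Automorphic

end
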